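import Mathlib.Analysis.Fourier.LpSpace
import Mathlib.Analysis.InnerProductSpace.Projection.Submodule
import Literature.NumberTheory.ConnesConsani2021.SemilocalSoninSpace
import Literature.NumberTheory.ConnesConsani2021.SoninProjection
import Summits.RiemannHypothesis.RiemannHypothesis.Theorems.SoninDistanceAbstract
import Summits.RiemannHypothesis.RiemannHypothesis.Theorems.SoninBandEnergyFourier
import HarnessLib

/-!
# The Sonin-space distance lemma on `L²(ℝ)`

Cell `rh-explicit`, seat cc-s2-1 (HOME `run/shared/lean/pub/rh-explicit/`; lead ruling R5-1, PHASE 1, task E2).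
Second of two files; the first (`SoninDistanceAbstract`) is the Hilbert-space lemma.

**Theorem** (`exists_mem_soninSpace_norm_sub_sq_le`).  Let `0 ≤ Λ < 1` be a *band-energy bound* for the pair of
windows `[−α, α]` (position) and `[−β, β]` (frequency): every `f ∈ L²(ℝ)` vanishing a.e. off `[−α, α]` has
`∫_{[−β,β]} |𝓕 f|² ≤ Λ ‖f‖²` (for `α = β = 1` this is the statement `λ₀(2π) ≤ Λ` about the top eigenvalue of the
prolate operator, proved with `Λ = 0.9999428` by seat cc-s2-3, files `SoninBandEnergy*`).  Then for every a.e.-even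
`η ∈ L²(ℝ)` vanishing a.e. on `[−α, α]` there is `ζ` in Sonin's space `S(α, β)` of Connes–Consani
(`Literature.NumberTheory.ConnesConsani2021.soninSpace`: even, zero on `[−α, α]`, Fourier transform zero on
`[−β, β]`) with
`‖η − ζ‖² ≤ (∫_{[−β,β]} |𝓕 η|²) / (1 − Λ)`,
and in particular (`norm_sub_soninProjection_sq_le`) the orthogonal projection `𝐒 η` onto `S(α, β)` is that close.
This is the analytic input "near-Sonin vector ⇒ Sonin vector at distance `≤ √ε/√(1 − λ₀)`" of the cell's finite
certificates against the operator statement `SemilocalSoninIneqOn` (`HOME/cc-s2-1/S2-CERT-SPEC.md`,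
`HOME/cc-s2-3/CERT-PLAN.md` §7; archived certificate `EXTREMALS/S2-sonin-refute-0549`), with the SHARP constant.

**Proof.**  Instantiate the abstract lemma with `E = L²(ℝ)`, `P = 1_{[−α,α]}·` (the orthogonal projection onto
`(vanishOn α)ᗮ`, `starProjection_vanishOn_orthogonal_eq`), `Q = 𝓕⁻¹ ∘ 1_{[−β,β]}· ∘ 𝓕` and, for evenness, the
reflection `R ξ = ξ(−·)`, which commutes with `P` (symmetric window) and with `Q` because the `L²` Fourier
transform commutes with reflection (`fourier_reflect`, proved here by Schwartz density from Mathlib's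
`SchwartzMap.toLp_fourier_eq` and `Real.fourierInv_eq_fourier_comp_neg`).

Proof-only file: no definitions (the operators are Mathlib's `Submodule.starProjection`,
`Lp.fourierTransformₗᵢ`, `Lp.compMeasurePreservingₗᵢ` applied to the tree's submodules), no named facts. [folklore]
-/

set_option linter.dupNamespace false  -- the mandated namespace repeats `RiemannHypothesis`

noncomputable section

open MeasureTheory Complex Set FourierTransform
open scoped Real ComplexConjugate InnerProductSpace ENNReal

namespace Summit.RiemannHypothesis.RiemannHypothesis.SoninDistance

open Literature.NumberTheory.ConnesConsani2021 Summit.RiemannHypothesis.RiemannHypothesis.BandEnergy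

/-! ## Time-limiting: the orthogonal projection onto `(vanishOn γ)ᗮ` is multiplication by `1_{[−γ, γ]}` -/

/-- The truncation `1_{[−γ,γ]} g` of `g ∈ L²(ℝ)` is in `L²(ℝ)`. [folklore] -/
theorem memLp_indicator_Icc (γ : ℝ) (g : Lp ℂ 2 (volume : Measure ℝ)) :
    MemLp ((Icc (-γ) γ).indicator (g : ℝ → ℂ)) 2 (volume : Measure ℝ) :=
  (Lp.memLp g).indicator measurableSet_Icc

/-- `1_{[−γ,γ]} g` is orthogonal to every function vanishing a.e. on `[−γ, γ]`. [folklore] -/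
theorem indicator_mem_vanishOn_orthogonal (γ : ℝ) (g : Lp ℂ 2 (volume : Measure ℝ)) :
    (memLp_indicator_Icc γ g).toLp _ ∈ (vanishOn γ)ᗮ := by
  rw [Submodule.mem_orthogonal]
  intro w hw
  rw [mem_vanishOn_iff] at hw
  rw [L2.inner_def]
  refine integral_eq_zero_of_ae ?_
  filter_upwards [hw, (memLp_indicator_Icc γ g).coeFn_toLp] with x hx hv
  rw [hv]
  by_cases hxI : x ∈ Icc (-γ) γ
  · simp [hx hxI]
  · simp [Set.indicator_of_notMem hxI]

/-- `g − 1_{[−γ,γ]} g` vanishes a.e. on `[−γ, γ]`. [folklore] -/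
theorem sub_indicator_mem_vanishOn (γ : ℝ) (g : Lp ℂ 2 (volume : Measure ℝ)) :
    g - (memLp_indicator_Icc γ g).toLp _ ∈ vanishOn γ := by
  rw [mem_vanishOn_iff]
  filter_upwards [Lp.coeFn_sub g ((memLp_indicator_Icc γ g).toLp _),
    (memLp_indicator_Icc γ g).coeFn_toLp] with x hx hv hxI
  rw [hx, Pi.sub_apply, hv, Set.indicator_of_mem hxI, sub_self]

/-- **The orthogonal projection onto `(vanishOn γ)ᗮ` is time-limiting**: `P_γ g = 1_{[−γ,γ]} g`. [folklore] -/
theorem starProjection_vanishOn_orthogonal_eq (γ : ℝ) [(vanishOn γ).HasOrthogonalProjection]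
    (g : Lp ℂ 2 (volume : Measure ℝ)) :
    (vanishOn γ)ᗮ.starProjection g = (memLp_indicator_Icc γ g).toLp _ :=
  Submodule.eq_starProjection_of_mem_orthogonal (indicator_mem_vanishOn_orthogonal γ g)
    (Submodule.le_orthogonal_orthogonal _ (sub_indicator_mem_vanishOn γ g))

/-- `P_γ g` vanishes a.e. off `[−γ, γ]`. [folklore] -/
theorem starProjection_vanishOn_orthogonal_ae_eq_zero (γ : ℝ) [(vanishOn γ).HasOrthogonalProjection]
    (g : Lp ℂ 2 (volume : Measure ℝ)) :
    ∀ᵐ x : ℝ, x ∉ Icc (-γ) γ → (((vanishOn γ)ᗮ.starProjection g : Lp ℂ 2 (volume : Measure ℝ)) : ℝ → ℂ) x = 0 := by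
  rw [starProjection_vanishOn_orthogonal_eq]
  filter_upwards [(memLp_indicator_Icc γ g).coeFn_toLp] with x hx hxI
  rw [hx, Set.indicator_of_notMem hxI]

/-- **`‖P_γ g‖² = ∫_{[−γ,γ]} |g|²`.** [folklore] -/
theorem norm_starProjection_vanishOn_orthogonal_sq (γ : ℝ) [(vanishOn γ).HasOrthogonalProjection]
    (g : Lp ℂ 2 (volume : Measure ℝ)) :
    ‖(vanishOn γ)ᗮ.starProjection g‖ ^ 2 = ∫ x in Icc (-γ) γ, ‖(g : ℝ → ℂ) x‖ ^ 2 := by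
  rw [starProjection_vanishOn_orthogonal_eq, norm_toLp_sq, ← integral_indicator measurableSet_Icc]
  refine integral_congr_ae (Filter.Eventually.of_forall fun x => ?_)
  by_cases hx : x ∈ Icc (-γ) γ
  · simp [Set.indicator_of_mem hx]
  · simp [Set.indicator_of_notMem hx]

/-- `P_γ ξ = 0 ↔ ξ ∈ vanishOn γ`. [folklore] -/
theorem starProjection_vanishOn_orthogonal_eq_zero_iff (γ : ℝ) [(vanishOn γ).HasOrthogonalProjection]
    (ξ : Lp ℂ 2 (volume : Measure ℝ)) :
    (vanishOn γ)ᗮ.starProjection ξ = 0 ↔ ξ ∈ vanishOn γ := by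
  rw [Submodule.starProjection_apply_eq_zero_iff, Submodule.orthogonal_orthogonal]

/-! ## The reflection `R ξ = ξ(−·)` and its commutation with the `L²` Fourier transform -/

/-- `R ξ = ξ ∘ (−)` a.e., for the reflection isometry `R = Lp.compMeasurePreservingₗᵢ ℂ (−) _` of `L²(ℝ)`. [folklore] -/
theorem coeFn_reflect (ξ : Lp ℂ 2 (volume : Measure ℝ)) :
    ((Lp.compMeasurePreservingₗᵢ ℂ (fun x : ℝ => -x) (Measure.measurePreserving_neg (volume : Measure ℝ)) ξ :
        Lp ℂ 2 (volume : Measure ℝ)) : ℝ → ℂ) =ᵐ[volume] fun x => (ξ : ℝ → ℂ) (-x) :=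
  Lp.coeFn_compMeasurePreserving ξ (Measure.measurePreserving_neg (volume : Measure ℝ))

/-- Pull-back of an a.e. equality along `x ↦ −x`. [folklore] -/
theorem ae_eq_comp_neg {f g : ℝ → ℂ} (h : f =ᵐ[volume] g) :
    (fun x : ℝ => f (-x)) =ᵐ[volume] fun x : ℝ => g (-x) :=
  (Measure.measurePreserving_neg (volume : Measure ℝ)).quasiMeasurePreserving.ae_eq_comp h

/-- `R (R ξ) = ξ`. [folklore] -/
theorem reflect_reflect (ξ : Lp ℂ 2 (volume : Measure ℝ)) :
    Lp.compMeasurePreservingₗᵢ ℂ (fun x : ℝ => -x) (Measure.measurePreserving_neg (volume : Measure ℝ))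
      (Lp.compMeasurePreservingₗᵢ ℂ (fun x : ℝ => -x) (Measure.measurePreserving_neg (volume : Measure ℝ)) ξ) = ξ := by
  apply Lp.ext
  filter_upwards [coeFn_reflect (Lp.compMeasurePreservingₗᵢ ℂ (fun x : ℝ => -x)
      (Measure.measurePreserving_neg (volume : Measure ℝ)) ξ), ae_eq_comp_neg (coeFn_reflect ξ)] with x hx hx'
  rw [hx, hx', neg_neg]

/-- `R` is symmetric: `⟪R ξ, η⟫ = ⟪ξ, R η⟫` (an isometric involution). [folklore] -/
theorem inner_reflect_left (ξ η : Lp ℂ 2 (volume : Measure ℝ)) :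
    ⟪Lp.compMeasurePreservingₗᵢ ℂ (fun x : ℝ => -x) (Measure.measurePreserving_neg (volume : Measure ℝ)) ξ, η⟫_ℂ =
      ⟪ξ, Lp.compMeasurePreservingₗᵢ ℂ (fun x : ℝ => -x) (Measure.measurePreserving_neg (volume : Measure ℝ)) η⟫_ℂ := by
  conv_lhs => rw [← reflect_reflect η]
  rw [LinearIsometry.inner_map_map]

/-- An a.e.-even function is fixed by `R`, and conversely. [folklore] -/
theorem reflect_eq_self_iff (ξ : Lp ℂ 2 (volume : Measure ℝ)) :
    Lp.compMeasurePreservingₗᵢ ℂ (fun x : ℝ => -x) (Measure.measurePreserving_neg (volume : Measure ℝ)) ξ = ξ ↔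
      ξ ∈ evenPart := by
  rw [mem_evenPart_iff]
  constructor
  · intro h
    have h1 := coeFn_reflect ξ
    rw [h] at h1
    filter_upwards [h1] with x hx
    exact hx.symm
  · intro h
    exact Lp.ext ((coeFn_reflect ξ).trans h)

/-- `R` preserves `vanishOn γ` (the window `[−γ, γ]` is symmetric). [folklore] -/
theorem reflect_mem_vanishOn {γ : ℝ} {ξ : Lp ℂ 2 (volume : Measure ℝ)} (hξ : ξ ∈ vanishOn γ) :
    Lp.compMeasurePreservingₗᵢ ℂ (fun x : ℝ => -x) (Measure.measurePreserving_neg (volume : Measure ℝ)) ξ ∈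
      vanishOn γ := by
  rw [mem_vanishOn_iff] at hξ ⊢
  have h' : ∀ᵐ x : ℝ, -x ∈ Icc (-γ) γ → (ξ : ℝ → ℂ) (-x) = 0 :=
    (Measure.measurePreserving_neg (volume : Measure ℝ)).quasiMeasurePreserving.ae hξ
  filter_upwards [coeFn_reflect ξ, h'] with x hx h1 hxI
  rw [hx]
  refine h1 ?_
  rw [mem_Icc] at hxI ⊢
  constructor <;> linarith [hxI.1, hxI.2]

/-- If `R` preserves a subspace `W` then it preserves `Wᗮ` (by symmetry of `R`). [folklore] -/
theorem reflect_mem_orthogonal {W : Submodule ℂ (Lp ℂ 2 (volume : Measure ℝ))}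
    (hW : ∀ ξ ∈ W, Lp.compMeasurePreservingₗᵢ ℂ (fun x : ℝ => -x)
      (Measure.measurePreserving_neg (volume : Measure ℝ)) ξ ∈ W)
    {ξ : Lp ℂ 2 (volume : Measure ℝ)} (hξ : ξ ∈ Wᗮ) :
    Lp.compMeasurePreservingₗᵢ ℂ (fun x : ℝ => -x) (Measure.measurePreserving_neg (volume : Measure ℝ)) ξ ∈ Wᗮ := by
  rw [Submodule.mem_orthogonal] at hξ ⊢
  intro w hw
  rw [← inner_reflect_left]
  exact hξ _ (hW w hw)

/-- **`R` commutes with time-limiting**: `P_γ (R ξ) = R (P_γ ξ)`. [folklore] -/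
theorem starProjection_vanishOn_orthogonal_reflect (γ : ℝ) [(vanishOn γ).HasOrthogonalProjection]
    (ξ : Lp ℂ 2 (volume : Measure ℝ)) :
    (vanishOn γ)ᗮ.starProjection
        (Lp.compMeasurePreservingₗᵢ ℂ (fun x : ℝ => -x) (Measure.measurePreserving_neg (volume : Measure ℝ)) ξ) =
      Lp.compMeasurePreservingₗᵢ ℂ (fun x : ℝ => -x) (Measure.measurePreserving_neg (volume : Measure ℝ))
        ((vanishOn γ)ᗮ.starProjection ξ) := by
  refine Submodule.eq_starProjection_of_mem_orthogonal ?_ ?_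
  · exact reflect_mem_orthogonal (fun ζ hζ => reflect_mem_vanishOn hζ) (Submodule.starProjection_apply_mem _ ξ)
  · rw [← map_sub]
    exact reflect_mem_orthogonal
      (fun ζ hζ => reflect_mem_orthogonal (fun w hw => reflect_mem_vanishOn hw) hζ)
      (Submodule.sub_starProjection_mem_orthogonal ξ)

/-- **The `L²` Fourier transform commutes with reflection**: `𝓕 (ξ(−·)) = (𝓕 ξ)(−·)` in `L²(ℝ)`.  By density of
Schwartz functions (`SchwartzMap.denseRange_toLpCLM`): on a Schwartz class both sides are the class of
`w ↦ 𝓕 f (−w)` (`SchwartzMap.toLp_fourier_eq`, `Real.fourierInv_eq_fourier_comp_neg`, `Real.fourierInv_eq_fourier_neg`),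
and both sides are continuous in `ξ`. [folklore] -/
theorem fourier_reflect (ξ : Lp ℂ 2 (volume : Measure ℝ)) :
    (𝓕 (Lp.compMeasurePreservingₗᵢ ℂ (fun x : ℝ => -x) (Measure.measurePreserving_neg (volume : Measure ℝ)) ξ) :
        Lp ℂ 2 (volume : Measure ℝ)) =
      Lp.compMeasurePreservingₗᵢ ℂ (fun x : ℝ => -x) (Measure.measurePreserving_neg (volume : Measure ℝ))
        (𝓕 ξ : Lp ℂ 2 (volume : Measure ℝ)) := by
  set R : Lp ℂ 2 (volume : Measure ℝ) →ₗᵢ[ℂ] Lp ℂ 2 (volume : Measure ℝ) :=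
    Lp.compMeasurePreservingₗᵢ ℂ (fun x : ℝ => -x) (Measure.measurePreserving_neg (volume : Measure ℝ)) with hR
  have hcl : IsClosed {ξ : Lp ℂ 2 (volume : Measure ℝ) |
      (𝓕 (R ξ) : Lp ℂ 2 (volume : Measure ℝ)) = R (𝓕 ξ : Lp ℂ 2 (volume : Measure ℝ))} :=
    isClosed_eq (continuous_fourier.comp R.continuous) (R.continuous.comp continuous_fourier)
  refine (SchwartzMap.denseRange_toLpCLM (E := ℝ) (F := ℂ) (p := (2 : ℝ≥0∞)) (μ := (volume : Measure ℝ))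
    ENNReal.ofNat_ne_top).induction_on ξ hcl ?_
  intro f
  rw [SchwartzMap.toLpCLM_apply]
  -- the reflected Schwartz function
  set g : SchwartzMap ℝ ℂ := SchwartzMap.compCLMOfContinuousLinearEquiv ℂ (ContinuousLinearEquiv.neg ℝ) f
    with hg
  have hg_apply : ∀ x : ℝ, g x = f (-x) := fun x => by
    simp [hg]
  -- `R [f] = [g]`
  have hRf : R (f.toLp 2) = g.toLp 2 := by
    apply Lp.ext
    filter_upwards [coeFn_reflect (f.toLp 2), ae_eq_comp_neg (SchwartzMap.coeFn_toLp f 2 (volume : Measure ℝ)),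
      SchwartzMap.coeFn_toLp g 2 (volume : Measure ℝ)] with x hx hx' hgx
    rw [hR, hx, hx', hgx, hg_apply]
  -- the Fourier transform of `g` is `w ↦ 𝓕 f (−w)`
  have hFg : ∀ w : ℝ, (𝓕 g) w = (𝓕 f) (-w) := fun w => by
    rw [SchwartzMap.fourier_coe, SchwartzMap.fourier_coe]
    have h1 : (g : ℝ → ℂ) = fun x => (f : ℝ → ℂ) (-x) := funext hg_apply
    rw [h1, ← Real.fourierInv_eq_fourier_comp_neg, Real.fourierInv_eq_fourier_neg]
  rw [hRf, SchwartzMap.toLp_fourier_eq, SchwartzMap.toLp_fourier_eq]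
  apply Lp.ext
  filter_upwards [SchwartzMap.coeFn_toLp (𝓕 g) 2 (volume : Measure ℝ), coeFn_reflect ((𝓕 f).toLp 2),
    ae_eq_comp_neg (SchwartzMap.coeFn_toLp (𝓕 f) 2 (volume : Measure ℝ))] with w h1 h2 h3
  rw [hR, h1, hFg, h2, h3]

/-! ## Band-limiting `Q = 𝓕⁻¹ P_β 𝓕` and the distance theorem -/

/-- Mathlib's `L²` Fourier transform notation `𝓕` on `Lp ℂ 2` is the isometry `Lp.fourierTransformₗᵢ ℝ ℂ`. [folklore] -/
theorem fourier_eq_fourierTransformₗᵢ (ξ : Lp ℂ 2 (volume : Measure ℝ)) :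
    (𝓕 ξ : Lp ℂ 2 (volume : Measure ℝ)) = Lp.fourierTransformₗᵢ ℝ ℂ ξ := rfl

/-- **`‖𝓕⁻¹ P_β 𝓕 ξ‖² = ∫_{[−β,β]} |𝓕 ξ|²`** (the band energy of `ξ` in the window `[−β, β]`). [folklore] -/
theorem norm_bandLimit_sq (β : ℝ) [(vanishOn β).HasOrthogonalProjection] (ξ : Lp ℂ 2 (volume : Measure ℝ)) :
    ‖(Lp.fourierTransformₗᵢ ℝ ℂ).symm ((vanishOn β)ᗮ.starProjection (Lp.fourierTransformₗᵢ ℝ ℂ ξ))‖ ^ 2 =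
      ∫ x in Icc (-β) β, ‖((𝓕 ξ : Lp ℂ 2 (volume : Measure ℝ)) : ℝ → ℂ) x‖ ^ 2 := by
  rw [LinearIsometryEquiv.norm_map, norm_starProjection_vanishOn_orthogonal_sq, fourier_eq_fourierTransformₗᵢ]

/-- **The Sonin-space distance lemma** (cell `rh-explicit`, task E2; sharp two-projection constant).  Let
`0 ≤ Λ < 1` bound the band energy in `[−β, β]` of every `L²` function supported in `[−α, α]`:
`∫_{[−β,β]} |𝓕 f|² ≤ Λ‖f‖²` (hypothesis `hband`; for `α = β = 1` the tree's `SoninBandEnergy*` files of seat cc-s2-3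
give `Λ = 0.9999428`).  Then every a.e.-even `η ∈ L²(ℝ)` vanishing a.e. on `[−α, α]` is within
`(∫_{[−β,β]} |𝓕 η|² / (1 − Λ))^{1/2}` of Sonin's space `S(α, β)`:
there is `ζ ∈ soninSpace α β` with `‖η − ζ‖² ≤ (∫_{[−β,β]} |𝓕 η|²) / (1 − Λ)`. [folklore] -/
theorem exists_mem_soninSpace_norm_sub_sq_le {α β Λ : ℝ} (hΛ0 : 0 ≤ Λ) (hΛ1 : Λ < 1)
    (hband : ∀ f : Lp ℂ 2 (volume : Measure ℝ), (∀ᵐ x : ℝ, x ∉ Icc (-α) α → (f : ℝ → ℂ) x = 0) →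
      ∫ x in Icc (-β) β, ‖((𝓕 f : Lp ℂ 2 (volume : Measure ℝ)) : ℝ → ℂ) x‖ ^ 2 ≤ Λ * ‖f‖ ^ 2)
    (η : Lp ℂ 2 (volume : Measure ℝ)) (hev : η ∈ evenPart) (hvan : η ∈ vanishOn α) :
    ∃ ζ ∈ soninSpace α β,
      ‖η - ζ‖ ^ 2 ≤ (∫ x in Icc (-β) β, ‖((𝓕 η : Lp ℂ 2 (volume : Measure ℝ)) : ℝ → ℂ) x‖ ^ 2) / (1 - Λ) := by
  haveI : CompleteSpace (vanishOn α) := (isClosed_vanishOn α).completeSpace_coe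
  haveI : CompleteSpace (vanishOn β) := (isClosed_vanishOn β).completeSpace_coe
  -- the three operators
  set F : Lp ℂ 2 (volume : Measure ℝ) ≃ₗᵢ[ℂ] Lp ℂ 2 (volume : Measure ℝ) := Lp.fourierTransformₗᵢ ℝ ℂ with hFdef
  set P : Lp ℂ 2 (volume : Measure ℝ) →L[ℂ] Lp ℂ 2 (volume : Measure ℝ) := (vanishOn α)ᗮ.starProjection
    with hPdef
  set Pb : Lp ℂ 2 (volume : Measure ℝ) →L[ℂ] Lp ℂ 2 (volume : Measure ℝ) := (vanishOn β)ᗮ.starProjection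
    with hPbdef
  set Q : Lp ℂ 2 (volume : Measure ℝ) →L[ℂ] Lp ℂ 2 (volume : Measure ℝ) :=
    (F.symm.toContinuousLinearEquiv : Lp ℂ 2 (volume : Measure ℝ) →L[ℂ] Lp ℂ 2 (volume : Measure ℝ)).comp
      (Pb.comp (F.toContinuousLinearEquiv : Lp ℂ 2 (volume : Measure ℝ) →L[ℂ] Lp ℂ 2 (volume : Measure ℝ)))
    with hQdef
  set R : Lp ℂ 2 (volume : Measure ℝ) →L[ℂ] Lp ℂ 2 (volume : Measure ℝ) :=
    (Lp.compMeasurePreservingₗᵢ ℂ (fun x : ℝ => -x)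
      (Measure.measurePreserving_neg (volume : Measure ℝ))).toContinuousLinearMap with hRdef
  have hQapply : ∀ x, Q x = F.symm (Pb (F x)) := fun x => rfl
  have hRapply : ∀ x, R x = Lp.compMeasurePreservingₗᵢ ℂ (fun x : ℝ => -x)
      (Measure.measurePreserving_neg (volume : Measure ℝ)) x := fun x => rfl
  have hF : ∀ x, (𝓕 x : Lp ℂ 2 (volume : Measure ℝ)) = F x := fun x => rfl
  -- `P`, `Pb` are symmetric idempotents
  have hP2 : ∀ x, P (P x) = P x := fun x =>
    Submodule.starProjection_eq_self_iff.mpr (Submodule.starProjection_apply_mem _ x)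
  have hPs : ∀ x y, ⟪P x, y⟫_ℂ = ⟪x, P y⟫_ℂ := Submodule.inner_starProjection_left_eq_right _
  have hPb2 : ∀ x, Pb (Pb x) = Pb x := fun x =>
    Submodule.starProjection_eq_self_iff.mpr (Submodule.starProjection_apply_mem _ x)
  have hPbs : ∀ x y, ⟪Pb x, y⟫_ℂ = ⟪x, Pb y⟫_ℂ := Submodule.inner_starProjection_left_eq_right _
  -- `Q` is a symmetric idempotent
  have hQ2 : ∀ x, Q (Q x) = Q x := fun x => by
    rw [hQapply, hQapply, F.apply_symm_apply, hPb2]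
  have hQs : ∀ x y, ⟪Q x, y⟫_ℂ = ⟪x, Q y⟫_ℂ := fun x y => by
    calc ⟪Q x, y⟫_ℂ = ⟪F.symm (Pb (F x)), F.symm (F y)⟫_ℂ := by rw [hQapply, F.symm_apply_apply]
      _ = ⟪Pb (F x), F y⟫_ℂ := F.symm.inner_map_map _ _
      _ = ⟪F x, Pb (F y)⟫_ℂ := hPbs _ _
      _ = ⟪F.symm (F x), F.symm (Pb (F y))⟫_ℂ := (F.symm.inner_map_map _ _).symm
      _ = ⟪x, Q y⟫_ℂ := by rw [F.symm_apply_apply, hQapply]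
  -- `‖Q x‖² = band energy of x`
  have hQnorm : ∀ x, ‖Q x‖ ^ 2 =
      ∫ t in Icc (-β) β, ‖((𝓕 x : Lp ℂ 2 (volume : Measure ℝ)) : ℝ → ℂ) t‖ ^ 2 := fun x => by
    rw [hQapply]; exact norm_bandLimit_sq β x
  -- the band-energy hypothesis
  have hPQ : ∀ x, ‖Q (P x)‖ ^ 2 ≤ Λ * ‖P x‖ ^ 2 := fun x => by
    rw [hQnorm]
    exact hband _ (starProjection_vanishOn_orthogonal_ae_eq_zero α x)
  -- `η ∈ ker P`
  have hη : P η = 0 := (starProjection_vanishOn_orthogonal_eq_zero_iff α η).mpr hvan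
  obtain ⟨ζ, hPζ, hQζ, hest, hinv⟩ :=
    exists_mem_ker_inter_ker_norm_sub_sq_le P Q hP2 hPs hQ2 hQs hΛ0 hΛ1 hPQ η hη
  -- evenness via the reflection `R`
  have hRP : ∀ x, R (P x) = P (R x) := fun x => by
    rw [hRapply, hRapply, hPdef, starProjection_vanishOn_orthogonal_reflect]
  have hRPb : ∀ x, R (Pb x) = Pb (R x) := fun x => by
    rw [hRapply, hRapply, hPbdef, starProjection_vanishOn_orthogonal_reflect]
  have hRF : ∀ x, F (R x) = R (F x) := fun x => by
    rw [← hF, ← hF, hRapply, hRapply, fourier_reflect]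
  have hRFs : ∀ x, F.symm (R x) = R (F.symm x) := fun x => by
    apply F.injective
    rw [F.apply_symm_apply, hRF, F.apply_symm_apply]
  have hRQ : ∀ x, R (Q x) = Q (R x) := fun x => by
    rw [hQapply, hQapply, hRF, ← hRPb, hRFs]
  have hRη : R η = η := by rw [hRapply]; exact (reflect_eq_self_iff η).mpr hev
  have hRζ : R ζ = ζ := hinv R hRP hRQ hRη
  -- conclusion
  refine ⟨ζ, ?_, ?_⟩
  · refine mem_soninSpace_iff'.mpr ⟨?_, ?_, ?_⟩
    · rw [← reflect_eq_self_iff, ← hRapply]; exact hRζ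
    · exact (starProjection_vanishOn_orthogonal_eq_zero_iff α ζ).mp hPζ
    · have h1 : Pb (F ζ) = 0 := by
        have h2 : F.symm (Pb (F ζ)) = 0 := by rw [← hQapply]; exact hQζ
        exact (LinearIsometryEquiv.map_eq_zero_iff F.symm).mp h2
      rw [hF]
      exact (starProjection_vanishOn_orthogonal_eq_zero_iff β (F ζ)).mp h1
  · rw [← hQnorm η]
    exact hest

/-- **Distance to Sonin's space, projection form**: under the hypotheses of
`exists_mem_soninSpace_norm_sub_sq_le`, the orthogonal projection `𝐒 η = soninProjection α β η` satisfies
`‖η − 𝐒 η‖² ≤ (∫_{[−β,β]} |𝓕 η|²) / (1 − Λ)`. [folklore] -/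
theorem norm_sub_soninProjection_sq_le {α β Λ : ℝ} (hΛ0 : 0 ≤ Λ) (hΛ1 : Λ < 1)
    (hband : ∀ f : Lp ℂ 2 (volume : Measure ℝ), (∀ᵐ x : ℝ, x ∉ Icc (-α) α → (f : ℝ → ℂ) x = 0) →
      ∫ x in Icc (-β) β, ‖((𝓕 f : Lp ℂ 2 (volume : Measure ℝ)) : ℝ → ℂ) x‖ ^ 2 ≤ Λ * ‖f‖ ^ 2)
    (η : Lp ℂ 2 (volume : Measure ℝ)) (hev : η ∈ evenPart) (hvan : η ∈ vanishOn α) :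
    ‖η - soninProjection α β η‖ ^ 2 ≤
      (∫ x in Icc (-β) β, ‖((𝓕 η : Lp ℂ 2 (volume : Measure ℝ)) : ℝ → ℂ) x‖ ^ 2) / (1 - Λ) := by
  obtain ⟨ζ, hζ, hest⟩ := exists_mem_soninSpace_norm_sub_sq_le hΛ0 hΛ1 hband η hev hvan
  have hmin : ‖η - soninProjection α β η‖ ≤ ‖η - ζ‖ := by
    rw [soninProjection, Submodule.starProjection_minimal]
    have hb : BddBelow (Set.range fun x : soninSpace α β => ‖η - (x : Lp ℂ 2 (volume : Measure ℝ))‖) :=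
      ⟨0, by rintro _ ⟨x, rfl⟩; exact norm_nonneg _⟩
    exact ciInf_le hb ⟨ζ, hζ⟩
  calc ‖η - soninProjection α β η‖ ^ 2 ≤ ‖η - ζ‖ ^ 2 := by gcongr
    _ ≤ _ := hest

end Summit.RiemannHypothesis.RiemannHypothesis.SoninDistance
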